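/-
Copyright (c) 2026 the pub-hodgecm-mathlib formalisation cell (harness21).  Prover seat hodgecm-mathlib-K2Liu-p12 (g0): Track B «K2-LIT»,
#184♮ = hLiu418 = stmt-HodgeConjecture-24832; Road Φ of socket #41, organ Φ5 «bad finite places» (LEAD F0P6-plan (g13) ruling «M-157c»: F3c), file F3c-1.
-/
import Literature.NumberTheory.GelbartRogawski1991.LocalUnitaryIntegralLattice     -- ★ `IsIntegralLoc`, valuation bookkeeping on `E ⊗ F_v`
import Literature.NumberTheory.Automorphic.QuadraticLocalBaseChange                -- ★ `toPlace`, `toLocalRing`, `valued_toPlace`, `galAdicCompletionMap_comp_toPlace`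
import Literature.NumberTheory.Automorphic.AddCharConductorExponent                -- ★ `mem_primePowBall_adicCompletion_iff`, `exists_coe_valued_eq_exp_neg_one`
import HarnessLib

/-!
# Crux `HLiu418`, Road Φ of socket #41, organ Φ5 — FILE F3c-1: VALUATION BALLS IN `E ⊗ F_v` AND IN `M_n(E ⊗ F_v)` (exponent bookkeeping)

Cell `hodgecm-mathlib`, crux item hLiu418 = `stmt-HodgeConjecture-24832`, route of record `HCCMUnconditional`; squad K2 ∕ K2Liu, road `K2_Liu`,
socket #41 `sig_K2LiuSiegelEisensteinContinuation`, Road Φ, organ Φ5 (census `K2/K2Liu-p12/g0/CENSUS-PHI5-…md`, spec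
`K2/K2Liu-p12/g0/SPEC-PHI5-F3-LeviSupplyAndCovering.K2Liu-p12-g0.md` §F3b∕F3c; the letter `B a` of the bus line K2Liu-p12 → K2Liu-p08 2026-09-04).
THEOREMS ONLY (no `def`, no `instance`, no `notation`, no named-fact hypothesis, no `sorry`); lane `--supports stmt-HodgeConjecture-24832`
(count-neutral helper; closes no socket by itself).  β-independent, group-free: pure valuation algebra on `R = E ⊗ F_v = Π_{w ∣ v} E_w`.

THE LETTER.  Fix a uniformizer `π` of `F_v` (`Valued.v π = exp(−1)`, ★ `exists_coe_valued_eq_exp_neg_one`) and write `ϖ_w := ι_w(π)` (★ `toPlace`).  An element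
`r ∈ R` LIES IN THE BALL OF EXPONENT `a ∈ ℤ` when `∀ w, Valued.v (r w) ≤ Valued.v (toPlace v w π) ^ a` (so exponent `0` = ★ `IsIntegralLoc`, and `ẑ := ι_v(z)` lies in
the ball `j` iff `z ∈ 𝔭_v^j`); a matrix lies in the ball `a` when all its entries do.  This file proves the bookkeeping F3c∕F4b (and F3b) consume:
* §1 elements: the thresholds are non-zero, `≤ 1`, and Galois-invariant (`valued_toPlace_uniformizer_*`); balls are antitone in `a`, closed under `+`, `Σ`, `σ = c ⊗ 1`
  (★ `valued_galAdicCompletionMap`), and MULTIPLICATIVE (`a`, `b` ↦ `a + b`); SCALING `z ∈ 𝔭_v^j ↔ ι_v z ∈ ball j` (★ `valued_toPlace`, ★ `mem_primePowBall_adicCompletion_iff`);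
  DESCENT `ι_v x ∈ ball a → x ∈ 𝔭_v^a` (the ramification index is `≥ 1`).
* §2 the TRACE-TYPE FUNCTIONAL: for an additive `τ : R → F_v` with `ι_v(τ r) = r + σ r` (the trace `Tr_{R∕F_v}`; hypothesis-first), `r ∈ ball a ⇒ τ r ∈ 𝔭_v^a` (no loss),
  and the COORDINATE RECOVERY `τ r, τ(ε r) ∈ 𝔭_v^m ⇒ r ∈ ball (m − c_ε)` for a `σ`-anti-invariant integral `ε` with `ϖ^{c_ε} ∣ 2ε` (`2εr = ε·ι(τ r) + ι(τ(εr))`) — the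
  non-degeneracy of the trace form, the engine of the COVERING clause of Karel's lemma.
* §3 matrices: balls of matrices are closed under `+`, products (`a + b`), scalars `ẑ •` (`+ j`), `σ`-transpose-conjugates, traces and entries.

## References
* [CasselsFrohlichANT1967] J. W. S. Cassels, A. Fröhlich (eds.), *Algebraic Number Theory* (1967), Ch. II §§10–11 (`L ⊗ K_v = Π L_w`, `|ι_w x|_w = |x|_v^{e_w}`), Ch. VII §1.1.
* [Casselman1980] W. Casselman, Compositio Math. 40 (1980), §3 (lattice bookkeeping for Jacquet integrals).
* [Shimura1997] G. Shimura, *Euler products and Eisenstein series*, CBMS 93 (1997), §18 (local coefficients at bad places).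
-/

set_option autoImplicit false
-- the mandated namespace repeats the single-problem summit's segment (`HodgeConjecture.HodgeConjecture`)
set_option linter.dupNamespace false

noncomputable section

open scoped Matrix
open NumberField IsDedekindDomain Matrix
open Literature.NumberTheory.Automorphic Literature.NumberTheory.Automorphic.UnitaryGroup

namespace Summit.HodgeConjecture.HodgeConjecture.Cruxes.HLiu418.K2LiuLocalRingValuationBalls

variable (F : Type) [Field F] [NumberField F] (E : Type) [Field E] [NumberField E] [Algebra F E] (c : E ≃ₐ[F] E)
  (v : HeightOneSpectrum (𝓞 F)) {π : v.adicCompletion F} (hπ : Valued.v π = WithZero.exp (-1 : ℤ))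

/-! ## §1 Balls in `E ⊗ F_v` -/

include hπ in
/-- `π ≠ 0`. [cite: CasselsFrohlichANT1967, Ch. II §10] -/
theorem uniformizer_ne_zero : π ≠ 0 := by
  intro h
  rw [h, map_zero] at hπ
  exact WithZero.exp_ne_zero hπ.symm

include hπ in
/-- the threshold `v_w(ϖ_w)` is non-zero. [cite: CasselsFrohlichANT1967, Ch. II §10] -/
theorem valued_toPlace_uniformizer_ne_zero (w : PlacesOver E v) : Valued.v (toPlace v w π) ≠ 0 :=
  (Valuation.ne_zero_iff _).2 ((map_ne_zero_iff _ (toPlace v w).injective).2 (uniformizer_ne_zero F v hπ))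

include hπ in
/-- the threshold `v_w(ϖ_w) = v_v(π)^{e(w|v)} = exp(−e(w|v))` with `e(w|v) ≥ 1`; in particular `v_w(ϖ_w) ≤ exp(−1) < 1`.
[cite: CasselsFrohlichANT1967, Ch. II §10] -/
theorem valued_toPlace_uniformizer_le (w : PlacesOver E v) : Valued.v (toPlace v w π) ≤ WithZero.exp (-1 : ℤ) := by
  haveI := PlacesOver.liesOver (E := E) w
  rw [valued_toPlace, hπ, ← WithZero.exp_nsmul, WithZero.exp_le_exp, smul_neg, neg_le_neg_iff, nsmul_eq_mul, mul_one]
  exact_mod_cast Nat.one_le_iff_ne_zero.2 (Ideal.IsDedekindDomain.ramificationIdx'_ne_zero_of_liesOver w.1.asIdeal v.ne_bot)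

include hπ in
/-- `v_w(ϖ_w) ≤ 1`. [cite: CasselsFrohlichANT1967, Ch. II §10] -/
theorem valued_toPlace_uniformizer_le_one (w : PlacesOver E v) : Valued.v (toPlace v w π) ≤ 1 :=
  (valued_toPlace_uniformizer_le F E v hπ w).trans (by rw [← WithZero.exp_zero, WithZero.exp_le_exp]; norm_num)

/-- the thresholds are GALOIS-INVARIANT: `v_{w'}(ϖ_{w'}) = v_w(ϖ_w)` along `σ • w = w'` (`σ ι_w = ι_{w'}`, `v ∘ σ = v`).
[cite: CasselsFrohlichANT1967, Ch. VII §1.1] -/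
theorem valued_toPlace_uniformizer_gal (σ : E ≃ₐ[F] E) (w w' : PlacesOver E v) (h : σ • w.1 = w'.1) (x : v.adicCompletion F) :
    Valued.v (toPlace v w' x) = Valued.v (toPlace v w x) := by
  rw [← galAdicCompletionMap_comp_toPlace σ w w' h, RingHom.comp_apply, valued_galAdicCompletionMap]

include hπ in
/-- balls are ANTITONE in the exponent: `a ≤ b ⇒ ball b ⊆ ball a`. [cite: CasselsFrohlichANT1967, Ch. II §10] -/
theorem ball_antitone {a b : ℤ} (hab : a ≤ b) {r : LocalRing E v} (hr : ∀ w : PlacesOver E v, Valued.v (r w) ≤ Valued.v (toPlace v w π) ^ b) :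
    ∀ w : PlacesOver E v, Valued.v (r w) ≤ Valued.v (toPlace v w π) ^ a := fun w =>
  (hr w).trans (zpow_le_zpow_right_of_le_one₀ (zero_lt_iff.2 (valued_toPlace_uniformizer_ne_zero F E v hπ w))
    (valued_toPlace_uniformizer_le_one F E v hπ w) hab)

/-- balls are closed under addition (ultrametric inequality). [cite: CasselsFrohlichANT1967, Ch. II §10] -/
theorem ball_add {a : ℤ} {r s : LocalRing E v} (hr : ∀ w : PlacesOver E v, Valued.v (r w) ≤ Valued.v (toPlace v w π) ^ a)
    (hs : ∀ w : PlacesOver E v, Valued.v (s w) ≤ Valued.v (toPlace v w π) ^ a) :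
    ∀ w : PlacesOver E v, Valued.v ((r + s) w) ≤ Valued.v (toPlace v w π) ^ a := fun w => by
  rw [Pi.add_apply]
  exact (Valuation.map_add _ _ _).trans (max_le (hr w) (hs w))

/-- balls are closed under negation. [cite: CasselsFrohlichANT1967, Ch. II §10] -/
theorem ball_neg {a : ℤ} {r : LocalRing E v} (hr : ∀ w : PlacesOver E v, Valued.v (r w) ≤ Valued.v (toPlace v w π) ^ a) :
    ∀ w : PlacesOver E v, Valued.v ((-r) w) ≤ Valued.v (toPlace v w π) ^ a := fun w => by
  rw [Pi.neg_apply, Valuation.map_neg]; exact hr w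

/-- balls are closed under finite sums. [cite: CasselsFrohlichANT1967, Ch. II §10] -/
theorem ball_sum {ι : Type*} (s : Finset ι) {a : ℤ} {f : ι → LocalRing E v}
    (hf : ∀ i ∈ s, ∀ w : PlacesOver E v, Valued.v (f i w) ≤ Valued.v (toPlace v w π) ^ a) :
    ∀ w : PlacesOver E v, Valued.v ((∑ i ∈ s, f i) w) ≤ Valued.v (toPlace v w π) ^ a := fun w => by
  rw [Finset.sum_apply]
  exact Valuation.map_sum_le _ fun i hi => hf i hi w

/-- `0` lies in every ball. [cite: CasselsFrohlichANT1967, Ch. II §10] -/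
theorem ball_zero (a : ℤ) : ∀ w : PlacesOver E v, Valued.v ((0 : LocalRing E v) w) ≤ Valued.v (toPlace v w π) ^ a := fun w => by
  rw [Pi.zero_apply, map_zero]; exact zero_le

include hπ in
/-- **balls MULTIPLY**: `ball a · ball b ⊆ ball (a + b)`. [cite: CasselsFrohlichANT1967, Ch. II §10] -/
theorem ball_mul {a b : ℤ} {r s : LocalRing E v} (hr : ∀ w : PlacesOver E v, Valued.v (r w) ≤ Valued.v (toPlace v w π) ^ a)
    (hs : ∀ w : PlacesOver E v, Valued.v (s w) ≤ Valued.v (toPlace v w π) ^ b) :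
    ∀ w : PlacesOver E v, Valued.v ((r * s) w) ≤ Valued.v (toPlace v w π) ^ (a + b) := fun w => by
  rw [Pi.mul_apply, map_mul, zpow_add₀ (valued_toPlace_uniformizer_ne_zero F E v hπ w)]
  exact mul_le_mul' (hr w) (hs w)

/-- `1` lies in the ball `0` (hence in every ball `a ≤ 0`). [cite: CasselsFrohlichANT1967, Ch. II §10] -/
theorem ball_one : ∀ w : PlacesOver E v, Valued.v ((1 : LocalRing E v) w) ≤ Valued.v (toPlace v w π) ^ (0 : ℤ) := fun w => by
  rw [Pi.one_apply, map_one, zpow_zero]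

/-- balls are stable under `σ = c ⊗ 1` (★ `conjLocal`): `(σ r)_w = c_w(r_{c⁻¹w})`, `v ∘ c_w = v`, thresholds Galois-invariant.
[cite: CasselsFrohlichANT1967, Ch. VII §1.1] -/
theorem ball_conjLocal {a : ℤ} {r : LocalRing E v} (hr : ∀ w : PlacesOver E v, Valued.v (r w) ≤ Valued.v (toPlace v w π) ^ a) :
    ∀ w : PlacesOver E v, Valued.v (conjLocal E c v r w) ≤ Valued.v (toPlace v w π) ^ a := fun w => by
  have hw : Valued.v (toPlace v w π) = Valued.v (toPlace v ⟨c⁻¹ • w.1, under_inv_smul_eq c w⟩ π) :=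
    valued_toPlace_uniformizer_gal F E v c ⟨c⁻¹ • w.1, under_inv_smul_eq c w⟩ w (smul_inv_smul c w.1) π
  have hv : Valued.v (conjLocal E c v r w) = Valued.v (r ⟨c⁻¹ • w.1, under_inv_smul_eq c w⟩) := by
    rw [conjLocal_apply, valued_galAdicCompletionMap]
  rw [hw, hv]
  exact hr ⟨c⁻¹ • w.1, under_inv_smul_eq c w⟩

include hπ in
/-- **SCALING: `z ∈ 𝔭_v^j ⇒ ι_v z ∈ ball j`** (`v_w(ι_w z) = v_v(z)^{e(w|v)}`, `v_w(ϖ_w) = v_v(π)^{e(w|v)}`).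
[cite: CasselsFrohlichANT1967, Ch. II §10] -/
theorem ball_toLocalRing_of_mem_primePowBall {j : ℤ} {z : v.adicCompletion F} (hz : z ∈ primePowBall (v.adicCompletion F) j) :
    ∀ w : PlacesOver E v, Valued.v (toLocalRing E v z w) ≤ Valued.v (toPlace v w π) ^ j := fun w => by
  rw [mem_primePowBall_adicCompletion_iff] at hz
  have hzj : Valued.v z ≤ Valued.v π ^ j := by rw [hπ, ← WithZero.exp_zsmul, smul_eq_mul, mul_neg_one]; exact hz
  rw [toLocalRing_apply, valued_toPlace, valued_toPlace]
  calc Valued.v z ^ v.asIdeal.ramificationIdx' w.1.asIdeal ≤ (Valued.v π ^ j) ^ v.asIdeal.ramificationIdx' w.1.asIdeal :=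
        pow_le_pow_left₀ zero_le hzj _
    _ = (Valued.v π ^ v.asIdeal.ramificationIdx' w.1.asIdeal) ^ j := by
        rw [← zpow_natCast, ← zpow_natCast (Valued.v π), ← _root_.zpow_mul, ← _root_.zpow_mul, mul_comm]

include hπ in
/-- **DESCENT: `ι_v x ∈ ball a ⇒ x ∈ 𝔭_v^a`** (read off at any place `w ∣ v`; `e(w|v) ≥ 1`). [cite: CasselsFrohlichANT1967, Ch. II §10] -/
theorem mem_primePowBall_of_ball_toLocalRing {a : ℤ} {x : v.adicCompletion F}
    (hx : ∀ w : PlacesOver E v, Valued.v (toLocalRing E v x w) ≤ Valued.v (toPlace v w π) ^ a) :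
    x ∈ primePowBall (v.adicCompletion F) a := by
  obtain ⟨w⟩ := (inferInstance : Nonempty (PlacesOver E v))
  haveI := PlacesOver.liesOver (E := E) w
  have he : v.asIdeal.ramificationIdx' w.1.asIdeal ≠ 0 := Ideal.IsDedekindDomain.ramificationIdx'_ne_zero_of_liesOver w.1.asIdeal v.ne_bot
  have h := hx w
  rw [toLocalRing_apply, valued_toPlace, valued_toPlace, ← zpow_natCast (Valued.v π), ← _root_.zpow_mul, mul_comm, _root_.zpow_mul, zpow_natCast] at h
  rw [mem_primePowBall_adicCompletion_iff, show WithZero.exp (-a) = Valued.v π ^ a by rw [hπ, ← WithZero.exp_zsmul, smul_eq_mul, mul_neg_one]]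
  exact (pow_le_pow_iff_left₀ zero_le zero_le he).1 h

/-! ## §2 The trace-type functional and coordinate recovery -/

include hπ in
/-- **`r ∈ ball a ⇒ τ r ∈ 𝔭_v^a`** for any `τ : R → F_v` with `ι_v(τ r) = r + σ r` (the trace `Tr_{R∕F_v}`; `v(r + σr) ≤ max`). NO loss of exponent.
[cite: CasselsFrohlichANT1967, Ch. II §10, Ch. VII §1.1] -/
theorem tau_mem_primePowBall {τ : LocalRing E v → v.adicCompletion F} (hτ : ∀ r, toLocalRing E v (τ r) = r + conjLocal E c v r)
    {a : ℤ} {r : LocalRing E v} (hr : ∀ w : PlacesOver E v, Valued.v (r w) ≤ Valued.v (toPlace v w π) ^ a) :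
    τ r ∈ primePowBall (v.adicCompletion F) a := by
  refine mem_primePowBall_of_ball_toLocalRing F E v hπ fun w => ?_
  rw [hτ]
  exact ball_add F E v hr (ball_conjLocal F E c v hr) w

include hπ in
/-- **COORDINATE RECOVERY (non-degeneracy of the trace form)**: for `ε ∈ R` integral with `σ ε = −ε` and `ϖ^{c_ε} ∣ 2ε` (`v_w(ϖ_w)^{c_ε} ≤ v_w(2ε_w)`):
`τ r ∈ 𝔭_v^m` and `τ(ε r) ∈ 𝔭_v^m` force `r ∈ ball (m − c_ε)` — because `2ε·r = ε·ι_v(τ r) + ι_v(τ(ε r))`.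
[cite: CasselsFrohlichANT1967, Ch. II §10] -/
theorem ball_of_tau_mem {τ : LocalRing E v → v.adicCompletion F} (hτ : ∀ r, toLocalRing E v (τ r) = r + conjLocal E c v r)
    {ε : LocalRing E v} (hεσ : conjLocal E c v ε = -ε) (hεint : ∀ w : PlacesOver E v, Valued.v (ε w) ≤ 1) {cε : ℤ}
    (hε : ∀ w : PlacesOver E v, Valued.v (toPlace v w π) ^ cε ≤ Valued.v ((2 * ε) w))
    {m : ℤ} {r : LocalRing E v} (h1 : τ r ∈ primePowBall (v.adicCompletion F) m) (h2 : τ (ε * r) ∈ primePowBall (v.adicCompletion F) m) :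
    ∀ w : PlacesOver E v, Valued.v (r w) ≤ Valued.v (toPlace v w π) ^ (m - cε) := by
  intro w
  have key : 2 * ε * r = ε * toLocalRing E v (τ r) + toLocalRing E v (τ (ε * r)) := by
    rw [hτ, hτ, map_mul, hεσ]; ring
  have hb1 := ball_toLocalRing_of_mem_primePowBall F E v hπ h1
  have hb2 := ball_toLocalRing_of_mem_primePowBall F E v hπ h2
  have hsum : Valued.v ((2 * ε * r) w) ≤ Valued.v (toPlace v w π) ^ m := by
    rw [key, Pi.add_apply, Pi.mul_apply]
    refine (Valuation.map_add _ _ _).trans (max_le ?_ (hb2 w))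
    rw [map_mul]
    calc Valued.v (ε w) * Valued.v (toLocalRing E v (τ r) w) ≤ 1 * Valued.v (toPlace v w π) ^ m := mul_le_mul' (hεint w) (hb1 w)
      _ = Valued.v (toPlace v w π) ^ m := one_mul _
  have hne : Valued.v (toPlace v w π) ≠ 0 := valued_toPlace_uniformizer_ne_zero F E v hπ w
  have h2ε : Valued.v (toPlace v w π) ^ cε * Valued.v (r w) ≤ Valued.v (toPlace v w π) ^ m := by
    calc Valued.v (toPlace v w π) ^ cε * Valued.v (r w) ≤ Valued.v ((2 * ε) w) * Valued.v (r w) := mul_le_mul' (hε w) le_rfl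
      _ = Valued.v ((2 * ε * r) w) := by rw [Pi.mul_apply (2 * ε) r, map_mul]
      _ ≤ Valued.v (toPlace v w π) ^ m := hsum
  rw [zpow_sub₀ hne, le_div_iff₀ (zero_lt_iff.2 (zpow_ne_zero cε hne)), mul_comm]
  exact h2ε

/-! ## §3 Balls of matrices -/

section Matrices

variable {m : Type*} [Fintype m] [DecidableEq m]

omit [DecidableEq m] in
include hπ in
/-- **products**: `ball a · ball b ⊆ ball (a + b)` for matrices (entrywise, ultrametric sums). [cite: CasselsFrohlichANT1967, Ch. II §10] -/
theorem mball_mul {a b : ℤ} {X Y : Matrix m m (LocalRing E v)}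
    (hX : ∀ i j (w : PlacesOver E v), Valued.v (X i j w) ≤ Valued.v (toPlace v w π) ^ a)
    (hY : ∀ i j (w : PlacesOver E v), Valued.v (Y i j w) ≤ Valued.v (toPlace v w π) ^ b) :
    ∀ i j (w : PlacesOver E v), Valued.v ((X * Y) i j w) ≤ Valued.v (toPlace v w π) ^ (a + b) := fun i j => by
  rw [Matrix.mul_apply]
  exact ball_sum F E v Finset.univ fun k _ => ball_mul F E v hπ (hX i k) (hY k j)

omit [Fintype m] [DecidableEq m] in
/-- sums of matrices. [cite: CasselsFrohlichANT1967, Ch. II §10] -/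
theorem mball_add {a : ℤ} {X Y : Matrix m m (LocalRing E v)}
    (hX : ∀ i j (w : PlacesOver E v), Valued.v (X i j w) ≤ Valued.v (toPlace v w π) ^ a)
    (hY : ∀ i j (w : PlacesOver E v), Valued.v (Y i j w) ≤ Valued.v (toPlace v w π) ^ a) :
    ∀ i j (w : PlacesOver E v), Valued.v ((X + Y) i j w) ≤ Valued.v (toPlace v w π) ^ a := fun i j => by
  rw [Matrix.add_apply]
  exact ball_add F E v (hX i j) (hY i j)

omit [Fintype m] [DecidableEq m] in
include hπ in
/-- scalars: `ẑ • X ∈ ball (j + a)` for `z ∈ 𝔭_v^j`, `X ∈ ball a`. [cite: CasselsFrohlichANT1967, Ch. II §10] -/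
theorem mball_smul {a j : ℤ} {z : v.adicCompletion F} (hz : z ∈ primePowBall (v.adicCompletion F) j) {X : Matrix m m (LocalRing E v)}
    (hX : ∀ i j (w : PlacesOver E v), Valued.v (X i j w) ≤ Valued.v (toPlace v w π) ^ a) :
    ∀ i k (w : PlacesOver E v), Valued.v ((toLocalRing E v z • X) i k w) ≤ Valued.v (toPlace v w π) ^ (j + a) := fun i k => by
  rw [Matrix.smul_apply, smul_eq_mul]
  exact ball_mul F E v hπ (ball_toLocalRing_of_mem_primePowBall F E v hπ hz) (hX i k)

omit [Fintype m] [DecidableEq m] in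
include hπ in
/-- antitone in the exponent. [cite: CasselsFrohlichANT1967, Ch. II §10] -/
theorem mball_antitone {a b : ℤ} (hab : a ≤ b) {X : Matrix m m (LocalRing E v)}
    (hX : ∀ i j (w : PlacesOver E v), Valued.v (X i j w) ≤ Valued.v (toPlace v w π) ^ b) :
    ∀ i j (w : PlacesOver E v), Valued.v (X i j w) ≤ Valued.v (toPlace v w π) ^ a := fun i j =>
  ball_antitone F E v hπ hab (hX i j)

omit [DecidableEq m] in
/-- traces: `X ∈ ball a ⇒ tr X ∈ ball a`. [cite: CasselsFrohlichANT1967, Ch. II §10] -/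
theorem ball_trace {a : ℤ} {X : Matrix m m (LocalRing E v)} (hX : ∀ i j (w : PlacesOver E v), Valued.v (X i j w) ≤ Valued.v (toPlace v w π) ^ a) :
    ∀ w : PlacesOver E v, Valued.v (X.trace w) ≤ Valued.v (toPlace v w π) ^ a := by
  rw [Matrix.trace]
  exact ball_sum F E v Finset.univ fun i _ => hX i i

omit [Fintype m] [DecidableEq m] in
/-- `σ`-conjugate transposes: `X ∈ ball a ⇒ σ(X)ᵀ ∈ ball a`. [cite: CasselsFrohlichANT1967, Ch. VII §1.1] -/
theorem mball_conjTranspose {a : ℤ} {X : Matrix m m (LocalRing E v)} (hX : ∀ i j (w : PlacesOver E v), Valued.v (X i j w) ≤ Valued.v (toPlace v w π) ^ a) :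
    ∀ i j (w : PlacesOver E v), Valued.v ((X.map (conjLocal E c v))ᵀ i j w) ≤ Valued.v (toPlace v w π) ^ a := fun i j => by
  rw [Matrix.transpose_apply, Matrix.map_apply]
  exact ball_conjLocal F E c v (hX j i)

omit [Fintype m] in
/-- the identity matrix lies in the ball `0`. [cite: CasselsFrohlichANT1967, Ch. II §10] -/
theorem mball_one : ∀ i j (w : PlacesOver E v), Valued.v ((1 : Matrix m m (LocalRing E v)) i j w) ≤ Valued.v (toPlace v w π) ^ (0 : ℤ) := by
  intro i j w
  rw [zpow_zero]
  by_cases h : i = j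
  · subst h; rw [Matrix.one_apply_eq, Pi.one_apply, map_one]
  · rw [Matrix.one_apply_ne h, Pi.zero_apply, map_zero]; exact zero_le

end Matrices

end Summit.HodgeConjecture.HodgeConjecture.Cruxes.HLiu418.K2LiuLocalRingValuationBalls

end
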